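import Summits.QuantumFields.YangMills.Theorems.SwapVirialDeficitSwapRingSectorPairing
import Summits.QuantumFields.YangMills.Theorems.SwapVirialDeficitOddSectorNoFlat
import Literature.MathematicalPhysics.QuantumFieldTheory.Balaban1983to89.T4WilsonLinkAffine
import Summits.QuantumFields.YangMills.Theorems.VirialFluxGapAnchorChartSmooth
import Summits.QuantumFields.YangMills.Theorems.LuscherReductionOneSiteLevelsMagnetic
import HarnessLib

/-!
# The σ-glued ring deficit as a POLYNOMIAL IN THE LINK QUATERNIONS (brick J5-R, history-level core, of memo-24197-massive-mode-rung)
# (free-hands support of ⟨stmt-QuantumFields-24197⟩ `SwapVirialDeficit.SwapGluedStiffness`; input of obligation (P) of ✓`BlowUp.smallBall_limit_real_of_blowUp_of_weight_ae`)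

Obligation (P) needs `t ↦ F^S_z(config(x; t))` to be `C²` (✓`BlowUp.tendsto_div_sq_of_contDiffAt`, w3 g64's ✓`blowUpLimit_eq_of_contDiffAt`).  The letters of the
configuration are `C^∞` in `t` THROUGH THEIR UNIT QUATERNIONS (w3 g64's ✓`contDiff_su2Quat_leaderTuple_dil3`, ✓`contDiff_su2Quat_follower`); this file supplies the
other half: the deficit is a polynomial in those quaternions.

* `qTimeCoupling`, `qPlaq`, `qWilson`, `qGauge`, `qTwist3`, `qSwap`, `qSeam`, ★ `qDeficit z` — the quaternionic transcription of ✓`SwapRing.swapRingDeficit_eq_sums`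
  (`Re tr(U V⁻¹) = 2·re(q_U · q̄_V)`, plaquette words with `q̄` for inverses, `g x · U · ḡ(x+ê)`, the centre signs of `tw_z`, the axis swap);
* ★★ `swapRingDeficit_eq_qDeficit` — `F^S_z(P) = qDeficit z (su2Quat ∘ P)` (✓`FemtoTransferGap.su2_trace_re_eq_quat`, ✓`su2Quat_mul`, ✓`T4WilsonLinkAffine.su2Quat_inv`,
  ✓`TT.twist3_apply`, ✓`configPerm_apply`, ✓`OddSectorNoFlat.su2Quat_negOne_mul`);
* ★★ `contDiff_qDeficit` — `qDeficit z` is `C^n` for every `n` on the quaternionic history space (finite sums∕products of the smooth maps `re`, `star` (✓`AnchorSlice.contDiff_quat_re/_star`), evaluation).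

USE (J5 proper): with the blown-up configuration written in quaternions, `g_x(t) = qDeficit z (Q_x(t))` and `Q_x` is `C^∞` in `t` letter by letter (products along the comb
for `glue`, the letters, `c`), so `ContDiffAt ℝ 2 g_x 0`.  The periodic ring differs only in the seam (`ringDeficit`); its transcription is the same with `qSwap` omitted.
HONEST LABEL: algebra∕calculus plumbing; NOT the fixed-`L` sharp law, NOT ⟨24197⟩; the Yang–Mills mass gap is NOT proved; no summit is proved by a line.  Seat ym-line-fcl-p3 g45
(cell ym-idea-1, free hands; item of record ⟨24085⟩ aside, untouched), `--supports stmt-QuantumFields-24197`.  Definitions + theorems, 0 `sorry`, standard axioms.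
References: [cite: Luscher1983, §2]; [folklore].
-/

set_option autoImplicit false

noncomputable section

open scoped BigOperators Quaternion ContDiff
open Quaternion
open Literature.MathematicalPhysics.QuantumFieldTheory hiding SU2
open Literature.MathematicalPhysics.QuantumLattice
open Literature.MathematicalPhysics.QuantumFieldTheory.Balaban1983to89.T4WilsonLinkAffine (su2Quat_inv)

namespace Summit.QuantumFields.YangMills.Theorems.SwapVirialDeficit.BlowUp

open Summit.QuantumFields.YangMills.Theorems.FemtoTransferGap
open Summit.QuantumFields.YangMills.Theorems.FemtoTransferGap.TT
open Summit.QuantumFields.YangMills.Theorems.SwapVirialDeficit.SwapRing (swapRingDeficit swapRingDeficit_eq_sums)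
open Summit.QuantumFields.YangMills.Theorems.SwapVirialDeficit.OddSectorNoFlat (su2Quat_negOne_mul)
open Summit.QuantumFields.YangMills.Theorems.VirialFluxGap.AnchorSlice (contDiff_quat_re contDiff_quat_star)

variable {L : ℕ} [NeZero L]

/-! ## §1 The quaternionic transcription -/

/-- `Re tr(U V⁻¹)` summed over the links, in quaternions: `Σ_e 2·re(U_e · V̄_e)`. [cite: Luscher1983, §2] -/
def qTimeCoupling (U V : Edge 3 L → ℍ) : ℝ := ∑ e : Edge 3 L, 2 * (U e * star (V e)).re

/-- The plaquette word `U(x,i) U(x+ê_i,j) Ū(x+ê_j,i) Ū(x,j)` in quaternions. [folklore] -/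
def qPlaq (U : Edge 3 L → ℍ) (x : Site 3 L) (i j : Fin 3) : ℍ :=
  U (x, i) * U (x.shift i, j) * star (U (x.shift j, i)) * star (U (x, j))

/-- The Wilson action of the spatial torus in quaternions: `Σ_p (2 − 2·re(plaquette word))`. [folklore] -/
def qWilson (U : Edge 3 L → ℍ) : ℝ := ∑ p : Plaquette 3 L, (2 - 2 * (qPlaq U p.1 p.2.1.1 p.2.1.2).re)

/-- A gauge transformation in quaternions: `U(x,i) ↦ g(x)·U(x,i)·ḡ(x+ê_i)`. [folklore] -/
def qGauge (g : Site 3 L → ℍ) (U : Edge 3 L → ℍ) : Edge 3 L → ℍ := fun e => g e.1 * U e * star (g (e.1.shift e.2))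

/-- The composite centre twist `tw_z` in quaternions: the links `(x, k)` with `x_k = 0` and `z k = 1` change sign. [cite: Luscher1983, §2] -/
def qTwist3 (z : Fin 3 → Bool) (U : Edge 3 L → ℍ) : Edge 3 L → ℍ := fun e => if e.1 e.2 = 0 ∧ z e.2 = true then -U e else U e

/-- The axis swap `σ = (0 1)` on configurations, in quaternions (✓`configPerm_apply`). [folklore] -/
def qSwap (U : Edge 3 L → ℍ) : Edge 3 L → ℍ := fun e => U (sitePerm (Equiv.swap (0 : Fin 3) 1).symm e.1, (Equiv.swap (0 : Fin 3) 1).symm e.2)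

/-- The σ-glued seam configuration `g · tw_z(σ U₀)` in quaternions. [cite: tHooft1979] -/
def qSeam (z : Fin 3 → Bool) (Q : (Fin (2 * L - 1 + 1) → Edge 3 L → ℍ) × (Site 3 L → ℍ)) : Edge 3 L → ℍ :=
  qGauge Q.2 (qTwist3 z (qSwap (Q.1 0)))

/-- ★ **The σ-glued deficit as a quaternion polynomial**: the transcription of ✓`swapRingDeficit_eq_sums`. [cite: Luscher1983, §2] -/
def qDeficit (z : Fin 3 → Bool) (Q : (Fin (2 * L - 1 + 1) → Edge 3 L → ℍ) × (Site 3 L → ℍ)) : ℝ :=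
  (∑ i : Fin (2 * L - 1), (6 * (L : ℝ) ^ 3 - qTimeCoupling (Q.1 i.castSucc) (Q.1 i.succ))) +
    (6 * (L : ℝ) ^ 3 - qTimeCoupling (Q.1 (Fin.last (2 * L - 1))) (qSeam z Q)) +
    (∑ i : Fin (2 * L - 1), (1 / 2 : ℝ) * (qWilson (Q.1 i.castSucc) + qWilson (Q.1 i.succ))) +
    (1 / 2 : ℝ) * (qWilson (Q.1 (Fin.last (2 * L - 1))) + qWilson (qSeam z Q))

/-! ## §2 The dictionary `SU(2) → ℍ` -/

/-- The time-like coupling in quaternions. [cite: Luscher1983, §2] -/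
theorem timeCoupling_eq_qTimeCoupling (U V : GaugeConfig 3 L SU2) :
    timeCoupling su2Rep U V = qTimeCoupling (fun e => su2Quat (U e)) (fun e => su2Quat (V e)) := by
  unfold timeCoupling qTimeCoupling
  refine Finset.sum_congr rfl fun e _ => ?_
  rw [show su2Rep (U e * (V e)⁻¹) = ((U e * (V e)⁻¹ : SU2) : Matrix (Fin 2) (Fin 2) ℂ) from rfl, su2_trace_re_eq_quat, su2Quat_mul, su2Quat_inv]

omit [NeZero L] in
/-- The plaquette holonomy in quaternions. [folklore] -/
theorem su2Quat_plaquetteHolonomy (U : GaugeConfig 3 L SU2) (x : Site 3 L) (i j : Fin 3) :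
    su2Quat (plaquetteHolonomy U x i j) = qPlaq (fun e => su2Quat (U e)) x i j := by
  simp only [plaquetteHolonomy, qPlaq, su2Quat_mul, su2Quat_inv]

/-- The Wilson action in quaternions. [folklore] -/
theorem wilsonAction_eq_qWilson (U : GaugeConfig 3 L SU2) : wilsonAction su2Rep U = qWilson (fun e => su2Quat (U e)) := by
  unfold wilsonAction qWilson
  refine Finset.sum_congr rfl fun p _ => ?_
  rw [show su2Rep (plaquetteHolonomy U p.1 p.2.1.1 p.2.1.2) = ((plaquetteHolonomy U p.1 p.2.1.1 p.2.1.2 : SU2) : Matrix (Fin 2) (Fin 2) ℂ) from rfl,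
    su2_trace_re_eq_quat, su2Quat_plaquetteHolonomy]
  norm_num

omit [NeZero L] in
/-- Gauge transformations in quaternions. [folklore] -/
theorem su2Quat_gaugeTransform (g : Site 3 L → SU2) (U : GaugeConfig 3 L SU2) :
    (fun e => su2Quat (gaugeTransform g U e)) = qGauge (fun x => su2Quat (g x)) (fun e => su2Quat (U e)) := by
  funext e
  simp only [gaugeTransform, qGauge, su2Quat_mul, su2Quat_inv]

omit [NeZero L] in
/-- The composite centre twist in quaternions. [cite: Luscher1983, §2] -/
theorem su2Quat_twist3 (z : Fin 3 → Bool) (U : GaugeConfig 3 L SU2) :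
    (fun e => su2Quat (TT.twist3 z U e)) = qTwist3 z (fun e => su2Quat (U e)) := by
  funext e
  rw [TT.twist3_apply]
  unfold qTwist3 TT.centreElem
  by_cases h0 : e.1 e.2 = 0
  · by_cases hz : z e.2 = true
    · rw [if_pos h0, if_pos hz, if_pos ⟨h0, hz⟩, su2Quat_negOne_mul]
    · rw [if_pos h0, if_neg hz, one_mul, if_neg (fun h => hz h.2)]
  · rw [if_neg h0, one_mul, if_neg (fun h => h0 h.1)]

omit [NeZero L] in
/-- The axis swap in quaternions. [folklore] -/
theorem su2Quat_configPerm_swap (U : GaugeConfig 3 L SU2) :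
    (fun e => su2Quat (configPerm (Equiv.swap (0 : Fin 3) 1) U e)) = qSwap (fun e => su2Quat (U e)) := by
  funext e
  rw [configPerm_apply]
  rfl

omit [NeZero L] in
/-- The σ-glued seam configuration in quaternions. [cite: tHooft1979] -/
theorem su2Quat_seam (z : Fin 3 → Bool) (P : (Fin (2 * L - 1 + 1) → GaugeConfig 3 L SU2) × (Site 3 L → SU2)) :
    (fun e => su2Quat (gaugeTransform P.2 (TT.twist3 z (configPerm (Equiv.swap (0 : Fin 3) 1) (P.1 0))) e)) =
      qSeam z (fun i e => su2Quat (P.1 i e), fun x => su2Quat (P.2 x)) := by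
  rw [su2Quat_gaugeTransform, su2Quat_twist3, su2Quat_configPerm_swap]
  rfl

/-- ★★ **THE σ-GLUED DEFICIT IS A QUATERNION POLYNOMIAL OF THE LINKS**: `F^S_z(P) = qDeficit z (su2Quat ∘ P)`. [cite: Luscher1983, §2] -/
theorem swapRingDeficit_eq_qDeficit (z : Fin 3 → Bool) (P : (Fin (2 * L - 1 + 1) → GaugeConfig 3 L SU2) × (Site 3 L → SU2)) :
    swapRingDeficit L z P = qDeficit z (fun i e => su2Quat (P.1 i e), fun x => su2Quat (P.2 x)) := by
  rw [swapRingDeficit_eq_sums]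
  unfold qDeficit
  simp only [timeCoupling_eq_qTimeCoupling, wilsonAction_eq_qWilson]
  rw [su2Quat_seam z P]

/-! ## §3 Smoothness -/

/-- The quaternionic time-like coupling is `C^n` in both configurations. [folklore] -/
theorem contDiff_qTimeCoupling {n : WithTop ℕ∞} :
    ContDiff ℝ n (fun p : (Edge 3 L → ℍ) × (Edge 3 L → ℍ) => qTimeCoupling p.1 p.2) := by
  unfold qTimeCoupling
  refine ContDiff.sum fun e _ => contDiff_const.mul (contDiff_quat_re.comp ?_)
  exact ((contDiff_apply ℝ ℍ e).comp contDiff_fst).mul (contDiff_quat_star.comp ((contDiff_apply ℝ ℍ e).comp contDiff_snd))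

/-- The quaternionic plaquette word is `C^n`. [folklore] -/
theorem contDiff_qPlaq {n : WithTop ℕ∞} (x : Site 3 L) (i j : Fin 3) : ContDiff ℝ n (fun U : Edge 3 L → ℍ => qPlaq U x i j) := by
  unfold qPlaq
  exact (((contDiff_apply ℝ ℍ _).mul (contDiff_apply ℝ ℍ _)).mul (contDiff_quat_star.comp (contDiff_apply ℝ ℍ _))).mul
    (contDiff_quat_star.comp (contDiff_apply ℝ ℍ _))

/-- The quaternionic Wilson action is `C^n`. [folklore] -/
theorem contDiff_qWilson {n : WithTop ℕ∞} : ContDiff ℝ n (qWilson (L := L)) := by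
  unfold qWilson
  exact ContDiff.sum fun p _ => contDiff_const.sub (contDiff_const.mul (contDiff_quat_re.comp (contDiff_qPlaq _ _ _)))

/-- The quaternionic gauge transformation is `C^n` in `(g, U)`. [folklore] -/
theorem contDiff_qGauge {n : WithTop ℕ∞} : ContDiff ℝ n (fun p : (Site 3 L → ℍ) × (Edge 3 L → ℍ) => qGauge p.1 p.2) := by
  refine contDiff_pi.2 fun e => ?_
  exact (((contDiff_apply ℝ ℍ e.1).comp contDiff_fst).mul ((contDiff_apply ℝ ℍ e).comp contDiff_snd)).mul
    (contDiff_quat_star.comp ((contDiff_apply ℝ ℍ (e.1.shift e.2)).comp contDiff_fst))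

/-- The quaternionic centre twist is `C^n`. [folklore] -/
theorem contDiff_qTwist3 {n : WithTop ℕ∞} (z : Fin 3 → Bool) : ContDiff ℝ n (qTwist3 (L := L) z) := by
  refine contDiff_pi.2 fun e => ?_
  by_cases h : e.1 e.2 = 0 ∧ z e.2 = true
  · have he : (fun U : Edge 3 L → ℍ => qTwist3 z U e) = fun U => -U e := by funext U; simp only [qTwist3, if_pos h]
    rw [he]; exact (contDiff_apply ℝ ℍ e).neg
  · have he : (fun U : Edge 3 L → ℍ => qTwist3 z U e) = fun U => U e := by funext U; simp only [qTwist3, if_neg h]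
    rw [he]; exact contDiff_apply ℝ ℍ e

/-- The quaternionic axis swap is `C^n`. [folklore] -/
theorem contDiff_qSwap {n : WithTop ℕ∞} : ContDiff ℝ n (qSwap (L := L)) :=
  contDiff_pi.2 fun _ => contDiff_apply ℝ ℍ _

/-- The quaternionic σ-seam configuration is `C^n` on the history space. [folklore] -/
theorem contDiff_qSeam {n : WithTop ℕ∞} (z : Fin 3 → Bool) :
    ContDiff ℝ n (qSeam (L := L) z) := by
  have h1 : ContDiff ℝ n (fun f : Fin (2 * L - 1 + 1) → Edge 3 L → ℍ => f 0) := contDiff_apply ℝ (Edge 3 L → ℍ) (0 : Fin (2 * L - 1 + 1))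
  have h2 : ContDiff ℝ n (fun Q : (Fin (2 * L - 1 + 1) → Edge 3 L → ℍ) × (Site 3 L → ℍ) => Q.1) := contDiff_fst
  have h0 : ContDiff ℝ n (fun Q : (Fin (2 * L - 1 + 1) → Edge 3 L → ℍ) × (Site 3 L → ℍ) => Q.1 0) := h1.comp h2
  have h3 : ContDiff ℝ n (fun Q : (Fin (2 * L - 1 + 1) → Edge 3 L → ℍ) × (Site 3 L → ℍ) => qSwap (Q.1 0)) := contDiff_qSwap.comp h0
  have h4 : ContDiff ℝ n (fun Q : (Fin (2 * L - 1 + 1) → Edge 3 L → ℍ) × (Site 3 L → ℍ) => qTwist3 z (qSwap (Q.1 0))) :=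
    (contDiff_qTwist3 z).comp h3
  have h5 : ContDiff ℝ n (fun Q : (Fin (2 * L - 1 + 1) → Edge 3 L → ℍ) × (Site 3 L → ℍ) => Q.2) := contDiff_snd
  have h6 : ContDiff ℝ n (fun Q : (Fin (2 * L - 1 + 1) → Edge 3 L → ℍ) × (Site 3 L → ℍ) => (Q.2, qTwist3 z (qSwap (Q.1 0)))) := h5.prodMk h4
  have h7 := (contDiff_qGauge (L := L) (n := n)).comp h6
  exact h7

/-- ★★ **THE QUATERNIONIC DEFICIT IS `C^n`** on the quaternionic history space, for every `n`. [folklore] -/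
theorem contDiff_qDeficit {n : WithTop ℕ∞} (z : Fin 3 → Bool) : ContDiff ℝ n (qDeficit (L := L) z) := by
  have h2 : ContDiff ℝ n (fun Q : (Fin (2 * L - 1 + 1) → Edge 3 L → ℍ) × (Site 3 L → ℍ) => Q.1) := contDiff_fst
  have hsl : ∀ i : Fin (2 * L - 1 + 1), ContDiff ℝ n (fun Q : (Fin (2 * L - 1 + 1) → Edge 3 L → ℍ) × (Site 3 L → ℍ) => Q.1 i) := by
    intro i
    have h1 : ContDiff ℝ n (fun f : Fin (2 * L - 1 + 1) → Edge 3 L → ℍ => f i) := contDiff_apply ℝ (Edge 3 L → ℍ) i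
    exact h1.comp h2
  have hT : ∀ i j : Fin (2 * L - 1 + 1), ContDiff ℝ n
      (fun Q : (Fin (2 * L - 1 + 1) → Edge 3 L → ℍ) × (Site 3 L → ℍ) => qTimeCoupling (Q.1 i) (Q.1 j)) := by
    intro i j
    have h := (contDiff_qTimeCoupling (L := L) (n := n)).comp ((hsl i).prodMk (hsl j))
    exact h
  have hS := contDiff_qSeam (L := L) (n := n) z
  have hTs : ContDiff ℝ n (fun Q : (Fin (2 * L - 1 + 1) → Edge 3 L → ℍ) × (Site 3 L → ℍ) =>
      qTimeCoupling (Q.1 (Fin.last (2 * L - 1))) (qSeam z Q)) := by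
    have h := (contDiff_qTimeCoupling (L := L) (n := n)).comp ((hsl (Fin.last (2 * L - 1))).prodMk hS)
    exact h
  have hW : ∀ i : Fin (2 * L - 1 + 1), ContDiff ℝ n (fun Q : (Fin (2 * L - 1 + 1) → Edge 3 L → ℍ) × (Site 3 L → ℍ) => qWilson (Q.1 i)) := by
    intro i
    have h := (contDiff_qWilson (L := L) (n := n)).comp (hsl i)
    exact h
  have hWs : ContDiff ℝ n (fun Q : (Fin (2 * L - 1 + 1) → Edge 3 L → ℍ) × (Site 3 L → ℍ) => qWilson (qSeam z Q)) := by
    have h := (contDiff_qWilson (L := L) (n := n)).comp hS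
    exact h
  unfold qDeficit
  refine ((ContDiff.add (ContDiff.add ?_ ?_) ?_).add ?_)
  · exact ContDiff.sum fun i _ => contDiff_const.sub (hT _ _)
  · exact contDiff_const.sub hTs
  · exact ContDiff.sum fun i _ => contDiff_const.mul ((hW _).add (hW _))
  · exact contDiff_const.mul ((hW _).add hWs)

end Summit.QuantumFields.YangMills.Theorems.SwapVirialDeficit.BlowUp

end
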